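import Summits.QuantumAdvantage.QuantumAdvantage.Theorems.LinnikCubicClassGroupsDegreeOnePrimesEscapeConjClassPNTBounds
import Summits.QuantumAdvantage.QuantumAdvantage.Theorems.LinnikCubicClassGroupsDegreeOnePrimesEscapeDivisionPNTIntervals
import HarnessLib

/-!
# Primes with Frobenius in a given CONJUGACY CLASS in every interval `(x, 2x]`, `x ≥ |d_N|^L`

Topic `Summits/QuantumAdvantage/QuantumAdvantage/Theorems`, cell B2b-1 (linnik-cubic), PART A (gen 13);
helper toward the crux `DegreeOnePrimesEscape` (stmt-QuantumAdvantage-11543) of route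
`LinnikCubicClassGroups`.  HONEST FRAMING: the value of this file is a THEOREM (kernel-checked, GRH-free,
Siegel-free, no hypothesis) — NOT summit progress.

**Theorem** (`exists_frobenius_isConj_mem_Ioc`, a Bertrand postulate for Frobenius conjugacy classes in the
Linnik range).  For `n > 1` there is `L = L(n) > 0` such that for every Galois number field `N` of degree `n`,
every `σ ∈ Gal(N/ℚ)` not generating `Gal(N/ℚ)` and EVERY `x ≥ |d_N|^L` there is a prime `p` with `x < p ≤ 2x`,
`p ∤ d_N`, whose Frobenius (at a prime of `N` with trivial inertia) is conjugate to `σ`.  Unconditional.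
The class analogue of `exists_frobenius_division_mem_Ioc`, from `frobeniusClass_PNT` with `ε = 1/7`.
[cite: LagariasMontgomeryOdlyzko1979, Theorem 1.1]
-/

noncomputable section

open scoped NumberField nonZeroDivisors
open Finset Real Ideal NumberField
open Literature.NumberTheory.NumberFields Literature.NumberTheory.LFunctions
  Literature.NumberTheory.LFunctions.NumberField

namespace Summit.QuantumAdvantage.QuantumAdvantage.Theorems.DegreeOnePrimesEscape

set_option maxHeartbeats 1600000 in
open scoped Classical in
/-- **A Bertrand postulate for Frobenius conjugacy classes in the Linnik range**: for `n > 1` there is `L > 0`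
such that for every Galois number field `N` of degree `n`, every `σ ∈ Gal(N/ℚ)` not generating the group and
every `x ≥ |d_N|^L` some prime `p ∈ (x, 2x]`, `p ∤ d_N`, has a Frobenius conjugate to `σ`.  Unconditional.
[cite: LagariasMontgomeryOdlyzko1979, Theorem 1.1] -/
theorem exists_frobenius_isConj_mem_Ioc (n : ℕ) (hn : 1 < n) :
    ∃ L : ℝ, 0 < L ∧ ∀ (N : Type) [Field N] [NumberField N] [IsGalois ℚ N],
      Module.finrank ℚ N = n → ∀ σ : N ≃ₐ[ℚ] N, Subgroup.zpowers σ ≠ ⊤ → ∀ x : ℝ, ((NumberField.discr N).natAbs : ℝ) ^ L ≤ x →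
        ∃ p : ℕ, p.Prime ∧ x < p ∧ (p : ℝ) ≤ 2 * x ∧ ¬ ((p : ℤ) ∣ NumberField.discr N) ∧
          ∃ (Q : Ideal (𝓞 N)) (_ : Q.IsMaximal) (_ : Q.LiesOver (span {(p : ℤ)})) (φ g : N ≃ₐ[ℚ] N),
            IsArithFrobAt ℤ φ Q ∧ Q.inertia (N ≃ₐ[ℚ] N) = ⊥ ∧
              g * φ * g⁻¹ = σ := by
  obtain ⟨L, c, hL, hc, hc4, h⟩ := frobeniusClass_PNT n hn (ε := 1 / 7) (by norm_num) (by norm_num)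
  refine ⟨L, hL, fun N _ _ _ hN σ hgen x hx => ?_⟩
  obtain ⟨hA, hB⟩ := h N hN σ hgen
  obtain ⟨hδ0, hδ1⟩ := classDensity_pos_le_one σ
  set δ : ℝ := (Nat.card {τ : N ≃ₐ[ℚ] N // IsConj σ τ} : ℝ) / Nat.card (N ≃ₐ[ℚ] N) with hδ
  have hN1 : 1 < Module.finrank ℚ N := by rw [hN]; exact hn
  set d : ℝ := ((NumberField.discr N).natAbs : ℝ) with hd
  have hd3 : (3 : ℝ) ≤ d := three_le_natAbs_discr_real N hN1
  have hx1 : 1 ≤ x := le_trans (Real.one_le_rpow (by linarith) hL.le) hx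
  have hx0 : 0 < x := by linarith
  have h2x : d ^ L ≤ 2 * x := by linarith
  have hδx : 0 < δ * x := by positivity
  have hgoal : ∑ p ∈ (Nat.primesLE ⌊x⌋₊).filter
        (fun p : ℕ => ¬ ((p : ℤ) ∣ NumberField.discr N) ∧
          ∃ (Q : Ideal (𝓞 N)) (_ : Q.IsMaximal) (_ : Q.LiesOver (span {(p : ℤ)})) (φ g : N ≃ₐ[ℚ] N),
            IsArithFrobAt ℤ φ Q ∧ Q.inertia (N ≃ₐ[ℚ] N) = ⊥ ∧
              g * φ * g⁻¹ = σ), Real.log p <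
      ∑ p ∈ (Nat.primesLE ⌊2 * x⌋₊).filter
        (fun p : ℕ => ¬ ((p : ℤ) ∣ NumberField.discr N) ∧
          ∃ (Q : Ideal (𝓞 N)) (_ : Q.IsMaximal) (_ : Q.LiesOver (span {(p : ℤ)})) (φ g : N ≃ₐ[ℚ] N),
            IsArithFrobAt ℤ φ Q ∧ Q.inertia (N ≃ₐ[ℚ] N) = ⊥ ∧
              g * φ * g⁻¹ = σ), Real.log p := by
    -- `S(x) < S(2x)` in each case of the prime number theorem
    by_cases hexc : ∃ β₁ : ℝ, dedekindZeta₁ N β₁ = 0 ∧ 1 - c / (Real.log d + Real.log 4) < β₁ ∧ β₁ < 1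
    · obtain ⟨β₁, hζ₁, hβ₁c, hβ₁1⟩ := hexc
      have hβ34 : 3 / 4 ≤ β₁ := three_quarters_le_of_window hc hc4 hd3 hβ₁c
      have hβ0 : 0 < β₁ := by linarith
      have hy0 : 0 ≤ x ^ β₁ / β₁ := div_nonneg (Real.rpow_nonneg hx0.le _) hβ0.le
      have h2β : (2 * x) ^ β₁ = (2 : ℝ) ^ β₁ * x ^ β₁ := Real.mul_rpow (by norm_num) hx0.le
      have h2β1 : (1 : ℝ) ≤ (2 : ℝ) ^ β₁ := Real.one_le_rpow (by norm_num) hβ0.le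
      have h2β2 : (2 : ℝ) ^ β₁ ≤ 2 := by
        have := Real.rpow_le_rpow_of_exponent_le (show (1:ℝ) ≤ 2 by norm_num) hβ₁1.le
        rwa [Real.rpow_one] at this
      obtain ⟨hB1, hB2⟩ := hB β₁ hζ₁ hβ₁c hβ₁1
      by_cases hζσ : dedekindZeta₁ (IntermediateField.fixedField (Subgroup.zpowers σ)) β₁ = 0
      · -- main term `F(t) = t − t^β/β`, `F(2x) ≥ 2 F(x)`
        obtain ⟨hxy, hbx⟩ := hB1 hζσ x hx
        obtain ⟨-, hb2x⟩ := hB1 hζσ (2 * x) h2x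
        have hux := (abs_le.mp hbx).2
        have hl2x := (abs_le.mp hb2x).1
        rw [h2β] at hl2x
        have hF : 2 * (x - x ^ β₁ / β₁) ≤ 2 * x - (2 : ℝ) ^ β₁ * x ^ β₁ / β₁ := by
          have : (2 : ℝ) ^ β₁ * x ^ β₁ / β₁ ≤ 2 * (x ^ β₁ / β₁) := by
            rw [mul_div_assoc]; exact mul_le_mul_of_nonneg_right h2β2 hy0
          linarith
        have hδF : δ * (2 * (x - x ^ β₁ / β₁)) ≤ δ * (2 * x - (2 : ℝ) ^ β₁ * x ^ β₁ / β₁) :=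
          mul_le_mul_of_nonneg_left hF hδ0.le
        have hδf : 0 < δ * (x - x ^ β₁ / β₁) := mul_pos hδ0 hxy
        linarith
      · -- main term `F(t) = t + t^β/β`
        have hbx := hB2 hζσ x hx
        have hb2x := hB2 hζσ (2 * x) h2x
        have hux := (abs_le.mp hbx).2
        have hl2x := (abs_le.mp hb2x).1
        rw [h2β] at hl2x
        have hF : x ^ β₁ / β₁ ≤ (2 : ℝ) ^ β₁ * x ^ β₁ / β₁ := by
          rw [mul_div_assoc]; exact le_mul_of_one_le_left hy0 h2β1
        have hyx : x ^ β₁ / β₁ ≤ 4 / 3 * x := by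
          have h1 : x ^ β₁ ≤ x := by
            have := Real.rpow_le_rpow_of_exponent_le hx1 hβ₁1.le; rwa [Real.rpow_one] at this
          rw [div_le_iff₀ hβ0]; nlinarith
        have hδy : δ * (x ^ β₁ / β₁) ≤ δ * (4 / 3 * x) := mul_le_mul_of_nonneg_left hyx hδ0.le
        have hδz : δ * (x ^ β₁ / β₁) ≤ δ * ((2 : ℝ) ^ β₁ * x ^ β₁ / β₁) :=
          mul_le_mul_of_nonneg_left hF hδ0.le
        linarith
    · have hbx := hA hexc x hx
      have hb2x := hA hexc (2 * x) h2x
      have hux := (abs_le.mp hbx).2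
      have hl2x := (abs_le.mp hb2x).1
      linarith
  obtain ⟨p, hp, hxp, hp2, hP⟩ := exists_prime_mem_Ioc_of_sum_lt hx0.le hgoal
  exact ⟨p, hp, hxp, hp2, hP.1, hP.2⟩

end Summit.QuantumAdvantage.QuantumAdvantage.Theorems.DegreeOnePrimesEscape

end
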